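import Literature.AlgebraicGeometry.HodgeTheory.QuaternionicQuarticDeckChart
import HarnessLib

/-!
# The μ₄×μ₂ BRANCH CHART of the normalised quaternionic quartic cover and its dictionary with the étale deck chart
# (programme «BRANCH CHART», brick BC-1 = the algebraic half of L6-2)

Layer `Literature/AlgebraicGeometry/HodgeTheory`. Definitions + proved API (no named fact). Written by the prover seat
`hodge-nonav-prover-Bx` (g21, cell `hodge-nonav`), memo `HOME/memos/S5-GLOBAL-ARCHITECTURE-Bx-g21.md` §2, for crux K1Q
`VeryGeneralQuaternionCommutatorsInHg` of `Summits/HodgeConjecture/HodgeConjecture/Theses/Q8SymplecticPowers.lean`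
(stmt-HodgeConjecture-24190; stub S9, S5-half). Companion of `QuaternionicQuarticDeckChart` (the étale chart `DeckRing a` over
`h = c·σc·α·ψ ≠ 0`, which misses the whole branch locus) and of the analytic files
`Literature/Geometry/ComplexAnalytic/EquivariantA3NormalForm`, `QuaternionicQuarticBranchChartA3`.

With the notation of `QuaternionicQuarticDeckChart` (affine chart `x₂ = 1`, `c, σc, α = u₀ − u₁, ψ`, `g = c σc³ α² ψ²`):

* §1 the BRANCH CHART `BranchRing a = R[u₀, u₁, s, y, v′]/(b₁, b₂, b₃)`, `b₁ = s⁴ − c·σc³`, `b₂ = y² − α·ψ`, `b₃ = v′·σc·α − 1`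
  — the μ₄×μ₂-cover `(s, y)` of the plane over `σc·α ≠ 0`, which CONTAINS the branch points over `c ∩ ψ` (the A₁ points of a
  general member, the `D₄ = ℂ²/Q₈` points of a d6 member); the involution `ι : (s, y) ↦ (−s, −y)` (`iotaB`) and the deck
  substitution `τ̃ : s ↦ i·s` (`tauB`) with the stability of the ideal (`branchIdeal_le_comap_iotaB/tauB`) and the induced
  algebra maps `iotaBHom`, `tauBHom`;
* the localised chart over `h ≠ 0`, the dictionary `DeckRing a → BranchRingLoc a` (`w = sy`, `w₁ = s²/σc`, `w₂ = s³y/σc²`,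
  `v = 1/h`) with its `ι`-invariance and `τ`-compatibility are in the sequel `QuaternionicQuarticBranchChartDictionary`.

Honest scope: explicit commutative algebra for one family of surfaces (no freeness / invariant-subring / étaleness statements
here — they are the next bricks of the memo); nothing here bears on HC.

## References

* [Kollar2007] J. Kollár, Lectures on Resolution of Singularities (2007), §3.3 (the family), §3.4.1 (group actions).
* [Hartshorne1977] R. Hartshorne, Algebraic Geometry (1977), II Ex. 2.9–2.14 (affine schemes and ring automorphisms).
-/

noncomputable section

open MvPolynomial

namespace Literature.AlgebraicGeometry.HodgeTheory.Q8Family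

universe v

/-! ### §1 The branch chart `R[u₀, u₁, s, y, v′]/(s⁴ − cσc³, y² − αψ, v′σcα − 1)` -/

section Branch

variable {R : Type v} [CommRing R] {e : ℕ} (a : CIdx e → R)

/-- Dehomogenisation at `x₂ = 1` into the branch-chart variables `u₀ = X 0`, `u₁ = X 1` of `R[u₀, u₁, s, y, v′]`
(`= MvPolynomial (Fin 5) R`; `s = X 2`, `y = X 3`, `v′ = X 4`). [cite: Hartshorne1977, II Ex. 2.14] -/
def dehomB : MvPolynomial (Fin 3) R →ₐ[R] MvPolynomial (Fin 5) R :=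
  aeval ![X 0, X 1, 1]

/-- `c(u₀, u₁, 1)` in the branch-chart variables. [cite: Kollar2007, §3.3] -/
def cB : MvPolynomial (Fin 5) R := dehomB (cOfR a)

/-- `(σc)(u₀, u₁, 1)` in the branch-chart variables. [cite: Kollar2007, §3.3] -/
def cB' : MvPolynomial (Fin 5) R := dehomB (rename (Equiv.swap (0 : Fin 3) 1) (cOfR a))

/-- `α = u₀ − u₁` in the branch-chart variables. [cite: Kollar2007, §3.3] -/
def αB : MvPolynomial (Fin 5) R := X 0 - X 1

/-- `ψ(u₀, u₁, 1)` in the branch-chart variables. [cite: Kollar2007, §3.3] -/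
def ψB : MvPolynomial (Fin 5) R := dehomB (ψOfR a)

/-- The relations `b₁ = s⁴ − c·σc³`, `b₂ = y² − α·ψ`, `b₃ = v′·σc·α − 1` of the branch chart. [cite: Kollar2007, §3.3] -/
def brel : Fin 3 → MvPolynomial (Fin 5) R
  | 0 => X 2 ^ 4 - cB a * cB' a ^ 3
  | 1 => X 3 ^ 2 - αB * ψB a
  | 2 => X 4 * (cB' a * αB) - 1

/-- The ideal `(b₁, b₂, b₃)`. [cite: Kollar2007, §3.3] -/
def branchIdeal : Ideal (MvPolynomial (Fin 5) R) := Ideal.span (Set.range (brel a))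

/-- **The coordinate ring of the μ₄×μ₂ branch chart** `R[u₀, u₁, s, y, v′]/(s⁴ − cσc³, y² − αψ, v′σcα − 1)` of the normalised
quaternionic quartic cover over `σc·α ≠ 0`. [cite: Kollar2007, §3.3] -/
abbrev BranchRing : Type v := MvPolynomial (Fin 5) R ⧸ branchIdeal a

/-- Each relation lies in the ideal. [cite: Kollar2007, §3.3] -/
theorem brel_mem_branchIdeal (k : Fin 3) : brel a k ∈ branchIdeal a := Ideal.subset_span ⟨k, rfl⟩

/-- A multiple of a relation lies in the ideal. [folklore] -/
private theorem mem_branchIdeal_of_eq_mul {p u : MvPolynomial (Fin 5) R} (k : Fin 3) (h : p = u * brel a k) :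
    p ∈ branchIdeal a := by
  rw [h]; exact Ideal.mul_mem_left _ u (brel_mem_branchIdeal a k)

/-- The covering involution `ι : (u₀, u₁, s, y, v′) ↦ (u₀, u₁, −s, −y, v′)`. [cite: Kollar2007, §3.4.1] -/
def iotaB (R : Type v) [CommRing R] : MvPolynomial (Fin 5) R →ₐ[R] MvPolynomial (Fin 5) R :=
  aeval ![X 0, X 1, -X 2, -X 3, X 4]

/-- `ι` on the generator `X 0`. [cite: Kollar2007, §3.4.1] -/
@[simp] theorem iotaB_X0 : iotaB R (X 0) = X 0 := by simp [iotaB]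
/-- `ι` on the generator `X 1`. [cite: Kollar2007, §3.4.1] -/
@[simp] theorem iotaB_X1 : iotaB R (X 1) = X 1 := by simp [iotaB]
/-- `ι` on the generator `X 2`. [cite: Kollar2007, §3.4.1] -/
@[simp] theorem iotaB_X2 : iotaB R (X 2) = -X 2 := by simp [iotaB]
/-- `ι` on the generator `X 3`. [cite: Kollar2007, §3.4.1] -/
@[simp] theorem iotaB_X3 : iotaB R (X 3) = -X 3 := by simp [iotaB]
/-- `ι` on the generator `X 4`. [cite: Kollar2007, §3.4.1] -/
@[simp] theorem iotaB_X4 : iotaB R (X 4) = X 4 := by simp [iotaB]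

/-- `ι` fixes everything dehomogenised from `ℂ[x₀, x₁, x₂]`. [cite: Kollar2007, §3.4.1] -/
theorem iotaB_dehomB (p : MvPolynomial (Fin 3) R) : iotaB R (dehomB p) = dehomB p := by
  change ((iotaB R).comp dehomB) p = dehomB p
  congr 1
  refine MvPolynomial.algHom_ext fun i => ?_
  fin_cases i <;> simp [iotaB, dehomB]

/-- `ι c = c`. [cite: Kollar2007, §3.4.1] -/
@[simp] theorem iotaB_cB : iotaB R (cB a) = cB a := iotaB_dehomB _
/-- `ι (σc) = σc`. [cite: Kollar2007, §3.4.1] -/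
@[simp] theorem iotaB_cB' : iotaB R (cB' a) = cB' a := iotaB_dehomB _
/-- `ι ψ = ψ`. [cite: Kollar2007, §3.4.1] -/
@[simp] theorem iotaB_ψB : iotaB R (ψB a) = ψB a := iotaB_dehomB _
/-- `ι α = α`. [cite: Kollar2007, §3.4.1] -/
@[simp] theorem iotaB_αB : iotaB R (αB : MvPolynomial (Fin 5) R) = αB := by
  simp only [αB, map_sub, iotaB_X0, iotaB_X1]

/-- `ι` maps `(b₁, b₂, b₃) ↦ (b₁, b₂, b₃)`. [cite: Kollar2007, §3.4.1] -/
theorem iotaB_rel_mem (k : Fin 3) : iotaB R (brel a k) ∈ branchIdeal a := by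
  fin_cases k
  · exact mem_branchIdeal_of_eq_mul a 0 (u := 1) (by simp [brel]; ring)
  · exact mem_branchIdeal_of_eq_mul a 1 (u := 1) (by simp [brel])
  · exact mem_branchIdeal_of_eq_mul a 2 (u := 1) (by simp [brel])

/-- The ideal is `ι`-stable. [cite: Kollar2007, §3.4.1] -/
theorem branchIdeal_le_comap_iotaB : branchIdeal a ≤ (branchIdeal a).comap (iotaB R) := by
  rw [branchIdeal, Ideal.span_le]
  rintro _ ⟨k, rfl⟩
  exact iotaB_rel_mem a k

/-- `ι ∘ ι = id`. [cite: Kollar2007, §3.4.1] -/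
theorem iotaB_comp_iotaB : (iotaB R).comp (iotaB R) = AlgHom.id R _ := by
  refine MvPolynomial.algHom_ext fun i => ?_
  fin_cases i <;> simp

/-- `ι` on `BranchRing a`. [cite: Kollar2007, §3.4.1] -/
def iotaBHom : BranchRing a →ₐ[R] BranchRing a :=
  Ideal.quotientMapₐ (branchIdeal a) (iotaB R) (branchIdeal_le_comap_iotaB a)

/-- `ι` after the quotient map. [cite: Kollar2007, §3.4.1] -/
@[simp] theorem iotaBHom_mk (p : MvPolynomial (Fin 5) R) :
    iotaBHom a (Ideal.Quotient.mk (branchIdeal a) p) = Ideal.Quotient.mk (branchIdeal a) (iotaB R p) := rfl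

end Branch

/-! ### The deck substitution `τ̃ : s ↦ i·s` on the branch chart (over a `ℂ`-algebra) -/

section BranchTau

variable {R : Type v} [CommRing R] [Algebra ℂ R] {e : ℕ} (a : CIdx e → R)

/-- `τ̃ : (u₀, u₁, s, y, v′) ↦ (u₀, u₁, i·s, y, v′)`. [cite: Kollar2007, §3.4.1] -/
def tauB (R : Type v) [CommRing R] [Algebra ℂ R] : MvPolynomial (Fin 5) R →ₐ[R] MvPolynomial (Fin 5) R :=
  aeval ![X 0, X 1, C (iR R) * X 2, X 3, X 4]

/-- `τ̃` on the generator `X 0`. [cite: Kollar2007, §3.4.1] -/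
@[simp] theorem tauB_X0 : tauB R (X 0) = X 0 := by simp [tauB]
/-- `τ̃` on the generator `X 1`. [cite: Kollar2007, §3.4.1] -/
@[simp] theorem tauB_X1 : tauB R (X 1) = X 1 := by simp [tauB]
/-- `τ̃` on the generator `X 2`. [cite: Kollar2007, §3.4.1] -/
@[simp] theorem tauB_X2 : tauB R (X 2) = C (iR R) * X 2 := by simp [tauB]
/-- `τ̃` on the generator `X 3`. [cite: Kollar2007, §3.4.1] -/
@[simp] theorem tauB_X3 : tauB R (X 3) = X 3 := by simp [tauB]
/-- `τ̃` on the generator `X 4`. [cite: Kollar2007, §3.4.1] -/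
@[simp] theorem tauB_X4 : tauB R (X 4) = X 4 := by simp [tauB]

/-- `τ̃` fixes everything dehomogenised from `ℂ[x₀, x₁, x₂]`. [cite: Kollar2007, §3.4.1] -/
theorem tauB_dehomB (p : MvPolynomial (Fin 3) R) : tauB R (dehomB p) = dehomB p := by
  change ((tauB R).comp dehomB) p = dehomB p
  congr 1
  refine MvPolynomial.algHom_ext fun i => ?_
  fin_cases i <;> simp [tauB, dehomB]

/-- `τ̃ c = c`. [cite: Kollar2007, §3.4.1] -/
@[simp] theorem tauB_cB : tauB R (cB a) = cB a := tauB_dehomB _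
/-- `τ̃ (σc) = σc`. [cite: Kollar2007, §3.4.1] -/
@[simp] theorem tauB_cB' : tauB R (cB' a) = cB' a := tauB_dehomB _
/-- `τ̃ ψ = ψ`. [cite: Kollar2007, §3.4.1] -/
@[simp] theorem tauB_ψB : tauB R (ψB a) = ψB a := tauB_dehomB _
/-- `τ̃ α = α`. [cite: Kollar2007, §3.4.1] -/
@[simp] theorem tauB_αB : tauB R (αB : MvPolynomial (Fin 5) R) = αB := by
  simp only [αB, map_sub, tauB_X0, tauB_X1]

/-- `(C i)⁴ = 1` in the branch-chart polynomial ring. [cite: Kollar2007, §3.4.1] -/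
theorem C_iR_pow_four : (C (iR R) : MvPolynomial (Fin 5) R) ^ 4 = 1 := by
  have h : (C (iR R) * C (iR R) : MvPolynomial (Fin 5) R) = -1 := by rw [← C_mul, iR_mul_iR, C_neg, C_1]
  calc (C (iR R) : MvPolynomial (Fin 5) R) ^ 4 = (C (iR R) * C (iR R)) * (C (iR R) * C (iR R)) := by ring
    _ = 1 := by rw [h]; ring

/-- `τ̃` maps `(b₁, b₂, b₃) ↦ (b₁, b₂, b₃)` (`i⁴ = 1`). [cite: Kollar2007, §3.4.1] -/
theorem tauB_rel_mem (k : Fin 3) : tauB R (brel a k) ∈ branchIdeal a := by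
  have h := C_iR_pow_four (R := R)
  fin_cases k
  · refine Ideal.subset_span ⟨0, ?_⟩
    simp [brel, mul_pow, h]
  · exact Ideal.subset_span ⟨1, by simp [brel]⟩
  · exact Ideal.subset_span ⟨2, by simp [brel]⟩

/-- The ideal is `τ̃`-stable. [cite: Kollar2007, §3.4.1] -/
theorem branchIdeal_le_comap_tauB : branchIdeal a ≤ (branchIdeal a).comap (tauB R) := by
  rw [branchIdeal, Ideal.span_le]
  rintro _ ⟨k, rfl⟩
  exact tauB_rel_mem a k

/-- `τ̃` on `BranchRing a`. [cite: Kollar2007, §3.4.1] -/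
def tauBHom : BranchRing a →ₐ[R] BranchRing a :=
  Ideal.quotientMapₐ (branchIdeal a) (tauB R) (branchIdeal_le_comap_tauB a)

/-- `τ̃` after the quotient map. [cite: Kollar2007, §3.4.1] -/
@[simp] theorem tauBHom_mk (p : MvPolynomial (Fin 5) R) :
    tauBHom a (Ideal.Quotient.mk (branchIdeal a) p) = Ideal.Quotient.mk (branchIdeal a) (tauB R p) := rfl

/-- `ι = τ̃² ` on `s` but NOT on `y`: `τ̃ ∘ τ̃` and `ι` agree on `u₀, u₁, s, v′` and differ by the sign of `y`
(`ι ∘ τ̃² : (s, y) ↦ (s, −y)` generates the `μ₂` of the μ₄×μ₂ cover). [cite: Kollar2007, §3.4.1] -/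
theorem tauB_comp_tauB_X2 : tauB R (tauB R (X 2 : MvPolynomial (Fin 5) R)) = iotaB R (X 2) := by
  have h : (C (iR R) * C (iR R) : MvPolynomial (Fin 5) R) = -1 := by rw [← C_mul, iR_mul_iR, C_neg, C_1]
  simp only [tauB_X2, map_mul, algHom_C, MvPolynomial.algebraMap_eq, iotaB_X2]
  linear_combination (X 2 : MvPolynomial (Fin 5) R) * h

end BranchTau

end Literature.AlgebraicGeometry.HodgeTheory.Q8Family

end
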